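import Summits.AtomisticToContinuum.FouriersLaw.Theorems.LatticeLandauDampingAbelThermodynamicLimitBulkWindowEquivalenceFiniteDLR
import Summits.AtomisticToContinuum.FouriersLaw.Theorems.LatticeLandauDampingAbelThermodynamicLimitUniformAnchoredCorrelationTailsSiteTails

/-!
# The free finite-volume Gibbs state is invariant under the severed flow of an interior window (stub (M1sev), statics)

Helper (`--supports stmt-AtomisticToContinuum-14013`) for the line `series-law-at-every-laplace-frequency`
(SketchIdeator2) of the crux `LatticeLandauDamping.AbelThermodynamicLimit`, stub (M1sev)
`stub_openChainSeveredLocality`. Registered sub-goal `pinnedChain_severedWindow_invariance`.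

Probabilistic input for the SEVERED side of the open-chain/severed-window comparison. Embed the phase space of the free
`N`-chain into `ℤ → ℝ × ℝ` along `{0, …, N-1}` (`OscillatorChain.embed`, zero elsewhere) and let `Λ` be a window whose
bonds are interior bonds of the chain (`bondSet Λ ⊆ {0, …, N-2}`). Then:

* `measurePreserving_severedFlow_map_embed` — the image of the free Gibbs state `μ_{N,T}` is invariant under LLL's
  severed flow `T^Λ_t` (the single-volume DLR equation of the embedded free state,
  `BulkWindow.gibbsMeasure_preimage_embed_eq_lintegral_chainSpecification`, and the invariance of every finite-volume
  Gibbs distribution under `T^Λ_t`, `measurePreserving_severedFlow_chainSpecification` = Liouville on the fibre +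
  conservation of `H_Λ`, LLL 1977 §4 remark (i));
* `lintegral_timeIntegral_momentum_pow_severed` — Tonelli + stationarity: `E ∫₀ᵗ p_l(T^Λ_r)^{2m} dr = t · E_{μ} p_l^{2m}`
  (Gaussian momenta, `commonPastBound_gibbsEvenMoments`);
* `timeIntegral_tail_severed` — Markov with the sixteenth
  power: `μ_{N,T}{θ < ∫₀ᵗ p_l(T^Λ_r ι z)² dr} ≤ C t^{16}/θ^{16}`, `C = T^{16} ∏_{j<16}(2j+1)`, uniformly in `N`, `Λ`, `l`;
* `embed_Icc_zero_eq_dite` — the embedding along `{0,…,N-1}` with zero boundary is the explicit `dite` of the registered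
  statement of (M1sev).

Folklore; no definitions.
-/

noncomputable section

open MeasureTheory ProbabilityTheory Set Filter Topology Finset
open scoped NNReal ENNReal BigOperators

namespace Summit.AtomisticToContinuum.FouriersLaw.Theorems.AbelThermodynamicLimit.SeriesLawAtEveryLaplaceFrequency

open Literature.MathematicalPhysics.KineticTheory Literature.MathematicalPhysics.KineticTheory.HeatConduction
open Literature.Probability.Process OscillatorChain BulkWindow
open Summit.AtomisticToContinuum.FouriersLaw.Theorems.PhononMeanFreePath
  (lightCone_pow_intervalIntegral_le commonPastBound_gibbsEvenMoments)

namespace SeveredLocality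

/-! ### The embedding along `{0, …, N-1}` -/

/-- The embedding of the free chain along `{0,…,N-1}` with zero boundary condition is the explicit `dite`
`x ↦ (q_{x}, p_{x})` for `0 ≤ x < N`, `(0, 0)` otherwise. [folklore] -/
theorem embed_Icc_zero_eq_dite {N : ℕ} (e : Fin N ≃ ↥(Finset.Icc (0 : ℤ) (0 + N - 1)))
    (he : ∀ k : Fin N, ((e k : ↥(Finset.Icc (0 : ℤ) (0 + N - 1))) : ℤ) = 0 + k) :
    embed (Finset.Icc (0 : ℤ) (0 + N - 1)) e (fun _ => (0, 0)) =
      fun (z : PhaseSpace N) (x : ℤ) =>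
        if h : 0 ≤ x ∧ x < N then (z.1 ⟨x.toNat, by omega⟩, z.2 ⟨x.toNat, by omega⟩) else (0, 0) := by
  funext z x
  by_cases h : 0 ≤ x ∧ x < N
  · rw [dif_pos h]
    exact embed_Icc_apply e he _ z x ⟨x.toNat, by omega⟩ (by push_cast; omega)
  · rw [dif_neg h]
    have hx : x ∉ Finset.Icc (0 : ℤ) (0 + N - 1) := by rw [Finset.mem_Icc]; omega
    exact embed_apply_of_not_mem _ _ hx

/-- The embedding reads the chain coordinates: `ι z l = (q_l, p_l)`. [folklore] -/
theorem embed_Icc_zero_apply {N : ℕ} (e : Fin N ≃ ↥(Finset.Icc (0 : ℤ) (0 + N - 1)))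
    (he : ∀ k : Fin N, ((e k : ↥(Finset.Icc (0 : ℤ) (0 + N - 1))) : ℤ) = 0 + k) (η₀ : ChainConfig)
    (z : PhaseSpace N) (l : Fin N) :
    embed (Finset.Icc (0 : ℤ) (0 + N - 1)) e η₀ z ((l : ℕ) : ℤ) = (z.1 l, z.2 l) :=
  embed_Icc_apply e he η₀ z _ l (by simp)

/-- The embedding is continuous. [folklore] -/
theorem continuous_embed {Λ : Finset ℤ} {m : ℕ} (e : Fin m ≃ ↥Λ) (η₀ : ChainConfig) :
    Continuous (embed Λ e η₀ : PhaseSpace m → ChainConfig) :=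
  continuous_embed_uncurry.comp (continuous_const.prodMk continuous_id)

/-! ### Invariance of the embedded free Gibbs state under the severed flow of an interior window -/

section Invariance

variable {ω₂ lam β : ℝ} (γ : ℝ) (hω : 0 < ω₂) (hl : 0 ≤ lam) (hβ : 0 ≤ β) {T : ℝ} (hT : 0 < T)
  (hB1 : (pinnedChain ω₂ lam β γ).CondB1) {N : ℕ} {s : ℤ} (e : Fin N ≃ ↥(Finset.Icc s (s + N - 1)))
  (he : ∀ k : Fin N, ((e k : ↥(Finset.Icc s (s + N - 1))) : ℤ) = s + k) (η₀ : ChainConfig)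
  {Λ : Finset ℤ} (hΛ : bondSet Λ ⊆ Finset.Icc s (s + N - 2))

include hω hl hβ hT he hΛ in
/-- **The image of the free Gibbs state under the embedding is invariant under the severed flow of an interior
window** (single-volume DLR equation of the embedded free state + invariance of the finite-volume Gibbs
distributions under `T^Λ_t`). [folklore] -/
theorem measurePreserving_severedFlow_map_embed (t : ℝ) :
    MeasurePreserving (severedFlow hB1 Λ t)
      (((pinnedChain ω₂ lam β γ).gibbsMeasure N T).map (embed (Finset.Icc s (s + N - 1)) e η₀))
      (((pinnedChain ω₂ lam β γ).gibbsMeasure N T).map (embed (Finset.Icc s (s + N - 1)) e η₀)) := by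
  set P := pinnedChain ω₂ lam β γ with hP
  set μ := P.gibbsMeasure N T with hμ
  set ι := embed (Finset.Icc s (s + N - 1)) e η₀ with hι
  have hιm : Measurable ι := measurable_embed η₀
  have hU2 : ContDiff ℝ 2 P.U := pinnedChain_contDiff_U ω₂ lam β γ
  have hV2 : ContDiff ℝ 2 P.V := pinnedChain_contDiff_V ω₂ lam β γ
  have hTm : Measurable (severedFlow hB1 Λ t) := measurable_severedFlow hB1 Λ hU2 hV2 t
  have hV0 : ∀ r, 0 ≤ P.V r := fun r => by show 0 ≤ r ^ 2 / 2 + β * r ^ 4 / 4; positivity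
  have hDLR : ∀ A : Set ChainConfig, MeasurableSet A → μ (ι ⁻¹' A) = ∫⁻ z, P.chainSpecification T Λ (ι z) A ∂μ :=
    fun A hA => gibbsMeasure_preimage_embed_eq_lintegral_chainSpecification P hU2.continuous.measurable
      hV2.continuous.measurable hT hV0 (integrable_exp_neg_pinning hT hω hl β γ)
      (pinnedChain_integrable_gibbsDensity hω hl hβ γ N hT) e he η₀ hΛ hA
  refine ⟨hTm, Measure.ext fun A hA => ?_⟩
  rw [Measure.map_apply hTm hA, Measure.map_apply hιm (hA.preimage hTm), Measure.map_apply hιm hA,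
    ← Set.preimage_comp, show severedFlow hB1 Λ t ∘ ι = fun z => severedFlow hB1 Λ t (ι z) from rfl,
    show (fun z => severedFlow hB1 Λ t (ι z)) ⁻¹' A = ι ⁻¹' (severedFlow hB1 Λ t ⁻¹' A) from rfl,
    hDLR _ (hA.preimage hTm), hDLR _ hA]
  refine lintegral_congr fun z => ?_
  exact (measurePreserving_severedFlow_chainSpecification hU2 hV2 hB1 T Λ (ι z) t).measure_preimage
    hA.nullMeasurableSet

include hω hl hβ hT he hΛ in
/-- Invariance in integrated form: `∫ F(T^Λ_t ι z) dμ_{N,T}(z) = ∫ F(ι z) dμ_{N,T}(z)` for measurable `F ≥ 0`. [folklore] -/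
theorem lintegral_comp_severedFlow_embed (t : ℝ) {F : ChainConfig → ℝ≥0∞} (hF : Measurable F) :
    ∫⁻ z, F (severedFlow hB1 Λ t (embed (Finset.Icc s (s + N - 1)) e η₀ z)) ∂((pinnedChain ω₂ lam β γ).gibbsMeasure N T) =
      ∫⁻ z, F (embed (Finset.Icc s (s + N - 1)) e η₀ z) ∂((pinnedChain ω₂ lam β γ).gibbsMeasure N T) := by
  have hιm : Measurable (embed (Finset.Icc s (s + N - 1)) e η₀) := measurable_embed η₀
  have hTm : Measurable (severedFlow hB1 Λ t) :=
    measurable_severedFlow hB1 Λ (pinnedChain_contDiff_U ω₂ lam β γ) (pinnedChain_contDiff_V ω₂ lam β γ) t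
  have h := (measurePreserving_severedFlow_map_embed γ hω hl hβ hT hB1 e he η₀ hΛ t).lintegral_comp hF
  rw [lintegral_map (show Measurable fun a => F (severedFlow hB1 Λ t a) from hF.comp hTm) hιm,
    lintegral_map hF hιm] at h
  exact h

end Invariance

/-! ### Measurability and the time-integrated momentum moments along the severed flow -/

section Moments

variable {ω₂ lam β : ℝ} (γ : ℝ) (hω : 0 < ω₂) (hl : 0 ≤ lam) (hβ : 0 ≤ β) {T : ℝ} (hT : 0 < T)
  (hB1 : (pinnedChain ω₂ lam β γ).CondB1) {N : ℕ} (e : Fin N ≃ ↥(Finset.Icc (0 : ℤ) (0 + N - 1)))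
  (he : ∀ k : Fin N, ((e k : ↥(Finset.Icc (0 : ℤ) (0 + N - 1))) : ℤ) = 0 + k)
  {Λ : Finset ℤ} (hΛ : bondSet Λ ⊆ Finset.Icc (0 : ℤ) (0 + N - 2))

/-- Joint measurability of `(z, r) ↦ T^Λ_r(ι z)` (arguments swapped, for Tonelli in time). [folklore] -/
theorem measurable_severedFlow_embed_swap (Λ : Finset ℤ) (η₀ : ChainConfig) :
    Measurable fun p : PhaseSpace N × ℝ => severedFlow hB1 Λ p.2 (embed (Finset.Icc (0 : ℤ) (0 + N - 1)) e η₀ p.1) := by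
  have h1 : Measurable fun p : PhaseSpace N × ℝ => (p.2, embed (Finset.Icc (0 : ℤ) (0 + N - 1)) e η₀ p.1) :=
    measurable_snd.prodMk ((measurable_embed η₀).comp measurable_fst)
  exact (measurable_severedFlow_uncurry hB1 Λ (pinnedChain_contDiff_U ω₂ lam β γ)
    (pinnedChain_contDiff_V ω₂ lam β γ)).comp h1

/-- Measurability of `z ↦ T^Λ_t(ι z)`. [folklore] -/
theorem measurable_severedFlow_embed (Λ : Finset ℤ) (η₀ : ChainConfig) (t : ℝ) :
    Measurable fun z : PhaseSpace N => severedFlow hB1 Λ t (embed (Finset.Icc (0 : ℤ) (0 + N - 1)) e η₀ z) := by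
  have h := (measurable_severedFlow hB1 Λ (pinnedChain_contDiff_U ω₂ lam β γ)
    (pinnedChain_contDiff_V ω₂ lam β γ) t).comp (measurable_embed η₀ :
      Measurable (embed (Finset.Icc (0 : ℤ) (0 + N - 1)) e η₀ : PhaseSpace N → ChainConfig))
  exact h

include hω hl hβ hT he hΛ in
/-- **Tonelli + stationarity + the Gaussian moment of order `2m`** along the severed flow:
`∫ (∫_{(0,t]} p_l(T^Λ_r ι z)^{2m} dr) dμ_{N,T}(z) = (T^m ∏_{j<m}(2j+1)) · t⁺`. [folklore] -/
theorem lintegral_timeIntegral_momentum_pow_severed (η₀ : ChainConfig) (t : ℝ) (l : Fin N) (m : ℕ) :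
    ∫⁻ z, (∫⁻ r in Ioc 0 t, ENNReal.ofReal
        ((severedFlow hB1 Λ r (embed (Finset.Icc (0 : ℤ) (0 + N - 1)) e η₀ z) ((l : ℕ) : ℤ)).2 ^ (2 * m)))
        ∂((pinnedChain ω₂ lam β γ).gibbsMeasure N T) =
      ENNReal.ofReal (T ^ m * ∏ j ∈ Finset.range m, (2 * (j : ℝ) + 1)) * ENNReal.ofReal t := by
  -- adapted from `BoxTail.lintegral_timeIntegral_momentum_pow` (stationarity of the kernel process there)
  haveI : IsProbabilityMeasure ((pinnedChain ω₂ lam β γ).gibbsMeasure N T) :=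
    pinnedChain_isProbabilityMeasure_gibbsMeasure hω hl hβ γ N hT
  have hf : Measurable fun zr : PhaseSpace N × ℝ => ENNReal.ofReal
      ((severedFlow hB1 Λ zr.2 (embed (Finset.Icc (0 : ℤ) (0 + N - 1)) e η₀ zr.1) ((l : ℕ) : ℤ)).2 ^ (2 * m)) :=
    ((measurable_snd.comp ((measurable_pi_apply _).comp
      (measurable_severedFlow_embed_swap γ hB1 e Λ η₀))).pow_const _).ennreal_ofReal
  rw [lintegral_lintegral_swap hf.aemeasurable]
  have hstat : ∀ r : ℝ, (∫⁻ z, ENNReal.ofReal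
      ((severedFlow hB1 Λ r (embed (Finset.Icc (0 : ℤ) (0 + N - 1)) e η₀ z) ((l : ℕ) : ℤ)).2 ^ (2 * m))
        ∂((pinnedChain ω₂ lam β γ).gibbsMeasure N T)) =
      ENNReal.ofReal (T ^ m * ∏ j ∈ Finset.range m, (2 * (j : ℝ) + 1)) := by
    intro r
    have hFm : Measurable fun σ : ChainConfig => ENNReal.ofReal ((σ ((l : ℕ) : ℤ)).2 ^ (2 * m)) :=
      ((measurable_snd.comp (measurable_pi_apply _)).pow_const _).ennreal_ofReal
    rw [lintegral_comp_severedFlow_embed γ hω hl hβ hT hB1 e he η₀ hΛ r hFm]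
    simp only [embed_Icc_zero_apply e he]
    obtain ⟨hint, hval⟩ := commonPastBound_gibbsEvenMoments ω₂ lam β γ hω hl hβ T hT N l m
    rw [← ofReal_integral_eq_lintegral_ofReal hint (ae_of_all _ fun y => (even_two_mul _).pow_nonneg _), hval]
  rw [lintegral_congr hstat, setLIntegral_const, Real.volume_Ioc, sub_zero]

include hω hl hβ hT he hΛ in
/-- **Time-integrated momentum tail along the severed flow, uniform in `N`, `Λ` and the site**: for `t ≥ 0`, `a > 0`,
`μ_{N,T}{a < ∫₀ᵗ p_l(T^Λ_r ι z)² dr} ≤ C t^{16}/a^{16}`, `C = T^{16} ∏_{j<16}(2j+1)` (Markov with the sixteenth power,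
Jensen in time, Tonelli, invariance). [folklore] -/
theorem timeIntegral_tail_severed (η₀ : ChainConfig) {t a : ℝ} (ht : 0 ≤ t) (ha : 0 < a) (l : Fin N) :
    (pinnedChain ω₂ lam β γ).gibbsMeasure N T
        {z | a < ∫ r in (0:ℝ)..t,
          (severedFlow hB1 Λ r (embed (Finset.Icc (0 : ℤ) (0 + N - 1)) e η₀ z) ((l : ℕ) : ℤ)).2 ^ 2} ≤
      ENNReal.ofReal ((T ^ 16 * ∏ j ∈ Finset.range 16, (2 * (j : ℝ) + 1)) * t ^ 16 / a ^ 16) := by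
  -- adapted from `BoxTail.timeIntegral_tail`
  haveI : IsProbabilityMeasure ((pinnedChain ω₂ lam β γ).gibbsMeasure N T) :=
    pinnedChain_isProbabilityMeasure_gibbsMeasure hω hl hβ γ N hT
  set M : ℝ := T ^ 16 * ∏ j ∈ Finset.range 16, (2 * (j : ℝ) + 1) with hM
  have hM0 : 0 ≤ M := by
    rw [hM]; exact mul_nonneg (pow_nonneg hT.le _) (Finset.prod_nonneg fun j _ => by positivity)
  set μ := (pinnedChain ω₂ lam β γ).gibbsMeasure N T with hμ
  set p : ℝ → PhaseSpace N → ℝ := fun r z =>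
    (severedFlow hB1 Λ r (embed (Finset.Icc (0 : ℤ) (0 + N - 1)) e η₀ z) ((l : ℕ) : ℤ)).2 with hp
  have hpc : ∀ z, Continuous fun r => p r z := fun z =>
    continuous_snd.comp ((continuous_apply _).comp (continuous_severedFlow_curve hB1 Λ _))
  have hpm : ∀ k : ℕ, Measurable fun zr : PhaseSpace N × ℝ => ENNReal.ofReal (p zr.2 zr.1 ^ k) := fun k =>
    ((measurable_snd.comp ((measurable_pi_apply _).comp
      (measurable_severedFlow_embed_swap γ hB1 e Λ η₀))).pow_const k).ennreal_ofReal
  set Xl : PhaseSpace N → ℝ≥0∞ := fun z => ∫⁻ r in Ioc 0 t, ENNReal.ofReal (p r z ^ 2) with hXl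
  set Yl : PhaseSpace N → ℝ≥0∞ := fun z => ∫⁻ r in Ioc 0 t, ENNReal.ofReal (p r z ^ 32) with hYl
  have hXlm : Measurable Xl := (hpm 2).lintegral_prod_right'
  have hofReal : ∀ {k : ℕ}, Even k → ∀ z : PhaseSpace N,
      ENNReal.ofReal (∫ r in (0:ℝ)..t, p r z ^ k) = ∫⁻ r in Ioc 0 t, ENNReal.ofReal (p r z ^ k) := by
    intro k hk z
    rw [intervalIntegral.integral_of_le ht]
    exact ofReal_integral_eq_lintegral_ofReal ((hpc z).pow k).integrableOn_Ioc (ae_of_all _ fun r => hk.pow_nonneg _)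
  have hJ : ∀ z, Xl z ^ 16 ≤ ENNReal.ofReal (t ^ 15) * Yl z := by
    intro z
    have hX0 : 0 ≤ ∫ r in (0:ℝ)..t, p r z ^ 2 := intervalIntegral.integral_nonneg ht fun r _ => sq_nonneg _
    have h1 := lightCone_pow_intervalIntegral_le (f := fun r => p r z ^ 2) ((hpc z).pow 2) (fun r => sq_nonneg _) ht 4
    have e32 : ∀ r, (p r z ^ 2) ^ (2 ^ 4) = p r z ^ 32 := fun r => by rw [← pow_mul]; norm_num
    simp only [e32] at h1
    norm_num at h1
    calc Xl z ^ 16 = ENNReal.ofReal ((∫ r in (0:ℝ)..t, p r z ^ 2) ^ 16) := by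
          rw [ENNReal.ofReal_pow hX0, hofReal even_two z]
      _ ≤ ENNReal.ofReal (t ^ 15 * ∫ r in (0:ℝ)..t, p r z ^ 32) := ENNReal.ofReal_le_ofReal h1
      _ = ENNReal.ofReal (t ^ 15) * Yl z := by
          rw [ENNReal.ofReal_mul (pow_nonneg ht 15), hofReal (by decide) z]
  have hsub : {z : PhaseSpace N | a < ∫ r in (0:ℝ)..t, p r z ^ 2} ⊆ {z | ENNReal.ofReal a ^ 16 ≤ Xl z ^ 16} := by
    intro z hz
    simp only [Set.mem_setOf_eq] at hz ⊢
    have h : ENNReal.ofReal a ≤ Xl z := by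
      show ENNReal.ofReal a ≤ ∫⁻ r in Ioc 0 t, ENNReal.ofReal (p r z ^ 2)
      rw [← hofReal even_two z]
      exact ENNReal.ofReal_le_ofReal hz.le
    gcongr
  have ha16 : ENNReal.ofReal a ^ 16 ≠ 0 := pow_ne_zero _ (ENNReal.ofReal_pos.2 ha).ne'
  have ha16' : ENNReal.ofReal a ^ 16 ≠ ∞ := ENNReal.pow_ne_top ENNReal.ofReal_ne_top
  have hYI : ∫⁻ z, Yl z ∂μ = ENNReal.ofReal M * ENNReal.ofReal t := by
    have := lintegral_timeIntegral_momentum_pow_severed γ hω hl hβ hT hB1 e he hΛ η₀ t l 16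
    simpa only [hYl, hp, hM] using this
  calc μ {z | a < ∫ r in (0:ℝ)..t, p r z ^ 2}
      ≤ μ {z | ENNReal.ofReal a ^ 16 ≤ Xl z ^ 16} := measure_mono hsub
    _ ≤ (∫⁻ z, Xl z ^ 16 ∂μ) / ENNReal.ofReal a ^ 16 :=
        meas_ge_le_lintegral_div (hXlm.pow_const 16).aemeasurable ha16 ha16'
    _ ≤ (∫⁻ z, ENNReal.ofReal (t ^ 15) * Yl z ∂μ) / ENNReal.ofReal a ^ 16 :=
        ENNReal.div_le_div_right (lintegral_mono fun z => hJ z) _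
    _ = ENNReal.ofReal (t ^ 15) * (ENNReal.ofReal M * ENNReal.ofReal t) / ENNReal.ofReal a ^ 16 := by
        rw [lintegral_const_mul' _ _ ENNReal.ofReal_ne_top, hYI]
    _ = ENNReal.ofReal (M * t ^ 16 / a ^ 16) := by
        rw [show M * t ^ 16 / a ^ 16 = t ^ 15 * (M * t) / a ^ 16 by ring,
          ENNReal.ofReal_div_of_pos (pow_pos ha 16), ENNReal.ofReal_mul (pow_nonneg ht 15),
          ENNReal.ofReal_mul hM0, ENNReal.ofReal_pow ha.le]

end Moments

end SeveredLocality

open SeveredLocality in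
/-- **Registered helper `pinnedChain_severedWindow_invariance`** (probabilistic input of stub (M1sev)
`stub_openChainSeveredLocality`, line `series-law-at-every-laplace-frequency`): for the pinned anharmonic chain and
`T > 0`, the free finite-volume Gibbs state `μ_{N,T}` embedded along `{0,…,N-1}` is invariant under LLL's severed flow
of every window `Λ` whose bonds are interior bonds of the chain (`∫ F(T^Λ_t ι z) dμ = ∫ F(ι z) dμ` for measurable
`F ≥ 0`), and consequently the time-integrated squared momentum along the severed flow has the `N`-, `Λ`- and
site-uniform tail `μ{a < ∫₀ᵗ p_l(T^Λ_r ι z)² dr} ≤ C t^{16}/a^{16}`, `C = T^{16}∏_{j<16}(2j+1)`. [folklore] -/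
theorem pinnedChain_severedWindow_invariance :
    ∀ ω₂ lam β γ : ℝ, 0 < ω₂ → 0 ≤ lam → 0 ≤ β → ∀ T : ℝ, 0 < T →
      ∀ (hB1 : (Literature.MathematicalPhysics.KineticTheory.HeatConduction.pinnedChain ω₂ lam β γ).CondB1) (N : ℕ)
        (e : Fin N ≃ ↥(Finset.Icc (0 : ℤ) (0 + N - 1))),
        (∀ k : Fin N, ((e k : ↥(Finset.Icc (0 : ℤ) (0 + N - 1))) : ℤ) = 0 + k) →
        ∀ (η₀ : Literature.MathematicalPhysics.KineticTheory.HeatConduction.ChainConfig) (Λ : Finset ℤ),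
          Literature.MathematicalPhysics.KineticTheory.HeatConduction.OscillatorChain.bondSet Λ ⊆
            Finset.Icc (0 : ℤ) (0 + N - 2) →
          (∀ (t : ℝ) (F : Literature.MathematicalPhysics.KineticTheory.HeatConduction.ChainConfig → ENNReal),
              Measurable F →
              ∫⁻ z, F (Literature.MathematicalPhysics.KineticTheory.HeatConduction.OscillatorChain.severedFlow hB1 Λ t
                  (Literature.MathematicalPhysics.KineticTheory.HeatConduction.OscillatorChain.embed
                    (Finset.Icc (0 : ℤ) (0 + N - 1)) e η₀ z))
                  ∂((Literature.MathematicalPhysics.KineticTheory.HeatConduction.pinnedChain ω₂ lam β γ).gibbsMeasure N T) =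
                ∫⁻ z, F (Literature.MathematicalPhysics.KineticTheory.HeatConduction.OscillatorChain.embed
                    (Finset.Icc (0 : ℤ) (0 + N - 1)) e η₀ z)
                  ∂((Literature.MathematicalPhysics.KineticTheory.HeatConduction.pinnedChain ω₂ lam β γ).gibbsMeasure N T)) ∧
          ∀ (t a : ℝ), 0 ≤ t → 0 < a → ∀ l : Fin N,
            (Literature.MathematicalPhysics.KineticTheory.HeatConduction.pinnedChain ω₂ lam β γ).gibbsMeasure N T
                {z | a < ∫ r in (0:ℝ)..t,
                  (Literature.MathematicalPhysics.KineticTheory.HeatConduction.OscillatorChain.severedFlow hB1 Λ r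
                    (Literature.MathematicalPhysics.KineticTheory.HeatConduction.OscillatorChain.embed
                      (Finset.Icc (0 : ℤ) (0 + N - 1)) e η₀ z) ((l : ℕ) : ℤ)).2 ^ 2} ≤
              ENNReal.ofReal ((T ^ 16 * ∏ j ∈ Finset.range 16, (2 * (j : ℝ) + 1)) * t ^ 16 / a ^ 16) :=
  fun _ _ _ γ hω hl hβ _ hT hB1 _ e he η₀ _ hΛ =>
    ⟨fun t _ hF => lintegral_comp_severedFlow_embed γ hω hl hβ hT hB1 e he η₀ hΛ t hF,
      fun _ _ ht ha l => timeIntegral_tail_severed γ hω hl hβ hT hB1 e he hΛ η₀ ht ha l⟩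

end Summit.AtomisticToContinuum.FouriersLaw.Theorems.AbelThermodynamicLimit.SeriesLawAtEveryLaplaceFrequency

end
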